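import Summits.Ventures.CertifiedArithmetic.LowPrec.OptTreePolySignedRefutation

/-!
# Eight signed summands already beat the tree-polynomial law once p ≥ 6 (OPTIMA T4(e), τ₈)

HONEST FRAMING (venture CertifiedArithmetic / cell `pub-lowprec`): certified error envelopes and
provably optimal rounding/accumulation schemes for low-precision formats under stated cost models;
every table by two implementations; no hardware or vendor claims.

`OptTreePolySignedRefutation`: the nine-term family `τ₉` violates the signed tree-polynomial law in
every format of precision `p ≥ 4`. Dropping one tail term gives `τ₈ = (((((·,·),·),((·,·),·)),·),·)`
on `(-4M², -(2M+2), -2M, -4M², -(2M+2), 2M-1, 4M, 4M)·q` (`M = 2^m`, `M_τ₈(u) = 1 + 5u + 2u²`): the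
same five roundings give `ŝ = -(8M²+16M)q`, now `s = -(8M²-4M+5)q`, `|ŝ - s| = (20M-5)q`,
`Σ|xᵢ| = (8M²+16M+3)q`, law `(5M+1)/(2M²+5M+1)`, and
`(20M-5)(2M²+5M+1) - (5M+1)(8M²+16M+3) = 2M² - 36M - 8 > 0 ⇔ M ≥ 19 ⇔ m ≥ 5 ⇔ p ≥ 6`.
So with EIGHT summands (`(n-1)u = 7u ≤ 7/64`) the signed law fails in bfloat16, binary16, binary32
(and every format with `p ≥ 6` and range `8M²+16M ≤ maxScaled`), while at `p = 4, 5` eight summands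
are not enough by implementation A's scans (`p = 4`: all 23 shapes `n = 8` EQ, C13; `p = 5`: all 23
EQ, lean g6) — `signed_law_fails_eight`, `not_signed_treePoly_law_eight`, kernel replay
`bf16_signed_eight` (`(-65536, -258, -256, -65536, -258, 255, 512, 512)`: `2555/133123 >
641/33409`).  Seven or fewer terms of this family never violate (margins `-u - 28u²`, `-3u - 20u²`).
-/

namespace Summit.Ventures.CertifiedArithmetic.LowPrec.Opt

open Literature.ComputerArithmetic.JeannerodRump2018
open Literature.ComputerArithmetic.JeannerodRump2018.SumTree
open Literature.ComputerArithmetic.FloatingPoint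
open Literature.ComputerArithmetic.FloatingPoint.Format
open Literature.ComputerArithmetic.FloatingPoint.MiniFloat

/-- `τ₈`: the nine-term family without its last tail term. -/
def signedTree8 (M q : ℚ) : SumTree :=
  .node (.node (.node
      (.node (.node (.leaf (-(4 * M ^ 2 * q))) (.leaf (-((2 * M + 2) * q)))) (.leaf (-(2 * M * q))))
      (.node (.node (.leaf (-(4 * M ^ 2 * q))) (.leaf (-((2 * M + 2) * q))))
        (.leaf ((2 * M - 1) * q))))
    (.leaf (4 * M * q))) (.leaf (4 * M * q))

/-- `τ₈` has eight leaves. -/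
theorem length_leaves_signedTree8 (M q : ℚ) : (leaves (signedTree8 M q)).length = 8 := by
  simp [signedTree8, leaves]

/-- Exact sum of `τ₈`: `-(8M² - 4M + 5)·q`. -/
theorem exact_signedTree8 (M q : ℚ) : exact (signedTree8 M q) = -(8 * M ^ 2 - 4 * M + 5) * q := by
  simp only [signedTree8, exact]; ring

/-- `Σ|xᵢ|` of `τ₈`: `(8M² + 16M + 3)·q`. -/
theorem absLeafSum_signedTree8 {M q : ℚ} (hM : 1 ≤ M) (hq : 0 < q) :
    absLeafSum (signedTree8 M q) = (8 * M ^ 2 + 16 * M + 3) * q := by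
  simp only [signedTree8, absLeafSum]
  have h1 : 0 ≤ 4 * M ^ 2 * q := by positivity
  have h2 : 0 ≤ (2 * M + 2) * q := by nlinarith
  have h3 : 0 ≤ 2 * M * q := by nlinarith
  have h4 : 0 ≤ (2 * M - 1) * q := by nlinarith
  have h5 : 0 ≤ 4 * M * q := by nlinarith
  rw [abs_neg, abs_neg, abs_neg, abs_of_nonneg h1, abs_of_nonneg h2, abs_of_nonneg h3,
    abs_of_nonneg h4, abs_of_nonneg h5]
  ring

/-- Tree polynomial of `τ₈`: `1 + 5u + 2u²`. -/
theorem treeM_signedTree8 {u : ℚ} (hu0 : 0 ≤ u) (M q : ℚ) :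
    treeM u (signedTree8 M q) = 1 + 5 * u + 2 * u ^ 2 := by
  simp only [signedTree8, treeM_node, treeM_leaf]
  have e1 : max (1 + u) 1 = 1 + u := max_eq_left (by linarith)
  have e1' : min (1 + u) 1 = 1 := min_eq_right (by linarith)
  have e0 : max (1 : ℚ) 1 = 1 := max_self 1
  have e0' : min (1 : ℚ) 1 = 1 := min_self 1
  rw [e0, e0', mul_one, e1, e1', mul_one]
  have e2 : max (1 + u + u) (1 + u + u) = 1 + u + u := max_self _
  have e2' : min (1 + u + u) (1 + u + u) = 1 + u + u := min_self _
  rw [e2, e2']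
  have e3 : max (1 + u + u + u * (1 + u + u)) 1 = 1 + u + u + u * (1 + u + u) :=
    max_eq_left (by nlinarith)
  have e3' : min (1 + u + u + u * (1 + u + u)) 1 = 1 := min_eq_right (by nlinarith)
  rw [e3, e3', mul_one]
  have e4 : max (1 + u + u + u * (1 + u + u) + u) 1 = 1 + u + u + u * (1 + u + u) + u :=
    max_eq_left (by nlinarith)
  have e4' : min (1 + u + u + u * (1 + u + u) + u) 1 = 1 := min_eq_right (by nlinarith)
  rw [e4, e4', mul_one]
  ring

section Format

variable {α : Format}

/-- `τ₈` evaluates IN THE FORMAT to `-(8M²+16M)·q` (`m ≥ 1`, range `8M²+16M ≤ maxScaled`). -/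
theorem eval_signedTree8 (h1 : 1 ≤ α.manBits)
    (hR : 8 * (2 ^ α.manBits) ^ 2 + 16 * 2 ^ α.manBits ≤ α.maxScaled) :
    eval (flα α) (signedTree8 ((2 ^ α.manBits : ℕ) : ℚ) α.quantum)
      = -((8 * ((2 ^ α.manBits : ℕ) : ℚ) ^ 2 + 16 * ((2 ^ α.manBits : ℕ) : ℚ)) * α.quantum) := by
  simp only [signedTree8, eval]
  rw [flα_E1 h1 hR, flα_E2 h1 hR, flα_E3 h1 hR, flα_E4 h1 hR, flα_E5 h1 hR, flα_E5 h1 hR]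

/-- `τ₈` is in-range data of `α`: it is a subtree of `τ₉`. -/
theorem treeInRange_signedTree8 (h1 : 1 ≤ α.manBits)
    (hR : 8 * (2 ^ α.manBits) ^ 2 + 16 * 2 ^ α.manBits ≤ α.maxScaled) :
    TreeInRange α (signedTree8 ((2 ^ α.manBits : ℕ) : ℚ) α.quantum) := by
  have h := treeInRange_signedTree9 (α := α) h1 hR
  simp only [signedTree9, TreeInRange] at h
  simp only [signedTree8, TreeInRange]
  exact h.1

/-- THE ARITHMETIC: for `M ≥ 19`, `(1 - 1/(1 + 5u + 2u²))·(8M²+16M+3)q < (20M-5)q`, `u = 1/(2M)`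
(equivalently `2M² - 36M - 8 > 0`). -/
theorem signed_family_ineq_eight {M q : ℚ} (hM : 19 ≤ M) (hq : 0 < q) :
    (1 - 1 / (1 + 5 * (1 / (2 * M)) + 2 * (1 / (2 * M)) ^ 2)) * ((8 * M ^ 2 + 16 * M + 3) * q)
      < (20 * M - 5) * q := by
  have hM0 : 0 < M := by linarith
  have hD : 0 < 2 * M ^ 2 + 5 * M + 1 := by positivity
  have key : 1 - 1 / (1 + 5 * (1 / (2 * M)) + 2 * (1 / (2 * M)) ^ 2)
      = (5 * M + 1) / (2 * M ^ 2 + 5 * M + 1) := by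
    field_simp; ring
  rw [key, div_mul_eq_mul_div, div_lt_iff₀ hD]
  have hpoly : 0 < 2 * M ^ 2 - 36 * M - 8 := by nlinarith
  nlinarith [mul_pos hq hpoly]

/-- **EIGHT SUMMANDS SUFFICE FOR `p ≥ 6`**: in every format with `m ≥ 5` and range
`8M²+16M ≤ maxScaled`, `τ₈` is in-range data with `n = 8`, `(n-1)u = 7u ≤ 1/2`, and
`(1 - 1/M_τ₈(u))·Σ|xᵢ| < |ŝ - s| = (20M-5)q`. -/
theorem signed_law_fails_eight (hm : 5 ≤ α.manBits)
    (hR : 8 * (2 ^ α.manBits) ^ 2 + 16 * 2 ^ α.manBits ≤ α.maxScaled) :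
    TreeInRange α (signedTree8 ((2 ^ α.manBits : ℕ) : ℚ) α.quantum) ∧
    (leaves (signedTree8 ((2 ^ α.manBits : ℕ) : ℚ) α.quantum)).length = 8 ∧
    (((leaves (signedTree8 ((2 ^ α.manBits : ℕ) : ℚ) α.quantum)).length : ℚ) - 1)
        * α.unitRoundoff ≤ 1 / 2 ∧
    (1 - 1 / treeM α.unitRoundoff (signedTree8 ((2 ^ α.manBits : ℕ) : ℚ) α.quantum))
        * absLeafSum (signedTree8 ((2 ^ α.manBits : ℕ) : ℚ) α.quantum)
      < |eval (flα α) (signedTree8 ((2 ^ α.manBits : ℕ) : ℚ) α.quantum)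
          - exact (signedTree8 ((2 ^ α.manBits : ℕ) : ℚ) α.quantum)| := by
  have h1 : 1 ≤ α.manBits := by omega
  have hq : 0 < α.quantum := α.quantum_pos
  have hM : (32 : ℚ) ≤ ((2 ^ α.manBits : ℕ) : ℚ) := by
    have : 2 ^ 5 ≤ 2 ^ α.manBits := Nat.pow_le_pow_right (by norm_num) hm
    exact_mod_cast this
  have hu := unitRoundoff_eq_inv_two_mul α
  refine ⟨treeInRange_signedTree8 h1 hR, length_leaves_signedTree8 _ _, ?_, ?_⟩
  · rw [length_leaves_signedTree8, hu]
    push_cast at hM ⊢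
    rw [show ((8 : ℚ) - 1) * (1 / (2 * 2 ^ α.manBits)) = (7 / 2) / 2 ^ α.manBits by
      field_simp; ring, div_le_iff₀ (by positivity)]
    linarith
  · rw [eval_signedTree8 h1 hR, exact_signedTree8,
      show -((8 * ((2 ^ α.manBits : ℕ) : ℚ) ^ 2 + 16 * ((2 ^ α.manBits : ℕ) : ℚ)) * α.quantum)
        - -(8 * ((2 ^ α.manBits : ℕ) : ℚ) ^ 2 - 4 * ((2 ^ α.manBits : ℕ) : ℚ) + 5) * α.quantum
        = -((20 * ((2 ^ α.manBits : ℕ) : ℚ) - 5) * α.quantum) by ring, abs_neg,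
      abs_of_pos (by nlinarith), treeM_signedTree8 α.unitRoundoff_pos.le,
      absLeafSum_signedTree8 (by linarith) hq, hu]
    exact signed_family_ineq_eight (by linarith) hq

/-- Hence the signed law restricted to `n ≤ 8` (indeed to `(n-1)u ≤ 7u`) is already false in every
format with `m ≥ 5` and that range. -/
theorem not_signed_treePoly_law_eight (hm : 5 ≤ α.manBits)
    (hR : 8 * (2 ^ α.manBits) ^ 2 + 16 * 2 ^ α.manBits ≤ α.maxScaled) :
    ¬ ∀ t : SumTree, TreeInRange α t → (leaves t).length ≤ 8 →
        |eval (flα α) t - exact t| ≤ (1 - 1 / treeM α.unitRoundoff t) * absLeafSum t := by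
  intro h
  obtain ⟨hin, hlen, -, hlt⟩ := signed_law_fails_eight hm hR
  exact absurd (h _ hin (by rw [hlen])) (not_le.mpr hlt)

end Format

/-- bfloat16 kernel replay of `τ₈` at unit scale: data `(-65536, -258, -256, -65536, -258, 255, 512,
512)`; `ŝ = -133120`, `s = -130565`, `Σ|xᵢ| = 133123`: ratio `2555/133123 = 0.019193` against the
law `641/33409 = 0.019186` (`(n-1)u = 7/256`). -/
theorem bf16_signed_eight :
    TreeInRange Format.BFloat16 (signedTree8 128 1) ∧
    eval (flα Format.BFloat16) (signedTree8 128 1) = -133120 ∧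
    exact (signedTree8 128 1) = -130565 ∧
    absLeafSum (signedTree8 128 1) = 133123 ∧
    1 - 1 / treeM Format.BFloat16.unitRoundoff (signedTree8 128 1) = 641 / 33409 ∧
    (641 / 33409 : ℚ) * 133123 < |(-133120 : ℚ) - (-130565)| := by
  have hu : Format.BFloat16.unitRoundoff = 1 / 256 := by rw [Format.unitRoundoff_eq]; rfl
  refine ⟨treeInRange_of_tirCheck _ (by decide +kernel), by decide +kernel, ?_, ?_, ?_, ?_⟩
  · rw [exact_signedTree8]; norm_num
  · rw [absLeafSum_signedTree8 (by norm_num) (by norm_num)]; norm_num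
  · rw [treeM_signedTree8 (by rw [hu]; norm_num), hu]; norm_num
  · norm_num [abs_of_neg]

end Summit.Ventures.CertifiedArithmetic.LowPrec.Opt
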